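import Summits.HodgeConjecture.HodgeConjecture.Theorems.R90S9HcoeffMemAtDatum         -- ★ (R90-IF-p03): `hcoeffMem_gammaSph` (the one-arch-class predecessor), `tuple_mem_support_of_slots`; cone ★ p862411, ★ p862394, ★ p862240, ★ Datum
import Summits.HodgeConjecture.HodgeConjecture.Theorems.R90S9ContribMemOfSlotsArch      -- ★ (this seat, «A2» FILE 1): `contribMem_of_slotsA_guarded` — the comparison with the two-member archimedean packet + guard
import HarnessLib

/-!
# R90-TF · S9 «InnerForm-13.3.6 (c)» — «A2» FILE 2: THE RE-CUT (CMP) BINDER `hcoeffMem` AT THE DATUM `Γ₀^{sph} = gammaSph X` WITH THE TWO-MEMBER ARCHIMEDEAN A-PACKET AT `ι`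
# AND THE COMPACT-TYPE GUARD (Rogawski 1990, proof of Thm. 14.6.4, p. 244 last display → p. 245 l. 2; §12.3 Prop. 12.3.3)

Cell `hodgecm-mathlib`, crux H413 (`stmt-HodgeConjecture-24833`, lane `--supports … --as helper`), route of record `HCCMUnconditional` (no route verbs; count-neutral).
Programme R90-TF (HUMAN RULING «R90-TF SLAB — MAX PUSH»; brief `director/R90-BRIEF.v2.md` 1f40d54518340a35), section S9 = InnerForm-13.3.6 (c) (base `R90-IF`); seat
R90-IF-p07 (g2); dealer R90-IF-plan (g2) RULING on FLAG F-R3-arch 2026-09-05T01:25:42Z (TRACK (b)) + own read 01:26:25Z.  THE REPAIR: the ★ (CMP) chain (★ p863200-class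
`hcoeffMem_*`) carries ONE archimedean class `a₀` with coefficient `+1` in both local-identity letters `hR₁ ∕ hR₂` and no compact-type guard; print (p. 244) and the tree's own
F0P3b clauses `GTraceProductForm ∕ HTraceProductForm` carry at the non-compact place `ι ∉ S₀` the two members `{πⁿ(ξ_ι), πˢ(ξ_ι)}` with opposite signs and the guard
`[cptXi₀ ξ]`.  THIS FILE re-derives the datum step of the chain — ★ `hcoeffMem_gammaSph` — with the corrected letter group `a₀ a₂ ha₀ ha₂ hane cpt hR₁ hR₂ hR₀G hR₀H`; every other
binder and the conclusion are ★ `hcoeffMem_gammaSph`'s, token for token.  THEOREMS ONLY: no `def`, no instance, no notation, no named fact, no `sorry`; imports ★ only;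
namespace `Summit.HodgeConjecture.HodgeConjecture.R90.S9`.
HONEST LABEL: HC_CM is proved only modulo the 7 printed citations (2 remaining named inputs: hLiu418 = stmt-HodgeConjecture-24832, h413 = stmt-HodgeConjecture-24833) —
until rung 0 closes.  A repair of a typed-hypothesis SHAPE; no printed statement about automorphic forms is proved here; the local identities, laws, (14.6.3) and transfer
existence stay HYPOTHESES as in ★ `hcoeffMem_gammaSph`.

[cite: Rogawski1990, §14.6 Thm. 14.6.4 and its proof pp. 244–245 (chunks p0238 L9 – p0239 L4); §12.3 p. 176, Prop. 12.3.3 p. 178; Prop. 13.8.1 p. 206; §13.1 p. 199, Prop. 13.1.4; §14.4 Props. 14.4.1 (a)(c), 14.4.2 (c) p. 236; §14.5 p. 237]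
[cite: FlathCorvallis1979, Thm. 3] [cite: JacquetLanglands1970, Lemma 16.1.1 pp. 497–499]
-/

set_option autoImplicit false
-- the mandated namespace repeats `HodgeConjecture.HodgeConjecture`, as in every `Theorems/*.lean` of this sub-problem
set_option linter.dupNamespace false

noncomputable section

namespace Summit.HodgeConjecture.HodgeConjecture.R90.S9

open Finset
open Literature.NumberTheory.Automorphic
open NumberField IsDedekindDomain MeasureTheory
open Literature.NumberTheory.Rogawski1990 Literature.NumberTheory.Automorphic.UnitaryGroup
open Literature.RepresentationTheory.KonnoKonno2007
open Summit.HodgeConjecture.HodgeConjecture.Cruxes.H413 Summit.HodgeConjecture.HodgeConjecture.Cruxes.H413.F0P3ClassTokenChoice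
open Summit.HodgeConjecture.HodgeConjecture.Cruxes.H413.F0P3GlobalPacket Summit.HodgeConjecture.HodgeConjecture.Cruxes.H413.F0P3LocalPacketKit
open InnerFormSec146
open scoped Matrix Classical ComplexOrder

section Datum

variable (L : Type) [Field L] [NumberField L] [IsCMField L] (ι₀ : L →+* ℂ) (H : Matrix (Fin 3) (Fin 3) L)
  (T : GL (Fin 3) ℂ) (hT : (T : Matrix (Fin 3) (Fin 3) ℂ)ᴴ * H.map ι₀ * (T : Matrix (Fin 3) (Fin 3) ℂ) = Literature.Geometry.ComplexHyperbolic.BallModel.J)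
  (νinf : @Measure (UnitaryGroup.arch (↥(maximalRealSubfield L)) L (IsCMField.complexConj L) 3 H) (borel _))
  (μv : ∀ v : HeightOneSpectrum (𝓞 ↥(maximalRealSubfield L)), @Measure ((cmDatum L 3 H).Local v) (borel _))
  (hdef : ∀ τ' : L →+* ℂ, InfinitePlace.mk τ' ≠ InfinitePlace.mk ι₀ → (H.map τ').PosDef)
  (hν : @Measure.IsHaarMeasure _ _ _ (borel _) νinf)
  (hμ : ∀ v : HeightOneSpectrum (𝓞 ↥(maximalRealSubfield L)), @Measure.IsHaarMeasure _ _ _ (borel _) (μv v))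
  (e : ∀ v : HeightOneSpectrum (𝓞 ↥(maximalRealSubfield L)), (cmDatum L 3 H).Local v → ℂ)
  (he : ∀ v, IsLocallyConstant (e v) ∧ HasCompactSupport (e v))


/-! ## The re-cut (CMP) binder with two archimedean members and the compact-type guard -/

variable {TG TH : Type}
  (μA : Measure (adelicGroupData (↥(maximalRealSubfield L)) L (IsCMField.complexConj L) 3 H).automorphicQuotient)
  [(adelicGroupData (↥(maximalRealSubfield L)) L (IsCMField.complexConj L) 3 H).IsAutomorphicMeasure μA]
  (Ξ : OneDimAutRepH L → PacketPrimeFin L H) {H' : Matrix (Fin 3) (Fin 3) L}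
  (𝔩 : ∀ v : HeightOneSpectrum (𝓞 ↥(maximalRealSubfield L)), LocalPacketKit L H' v)

set_option maxHeartbeats 1600000 in
include hdef hν hμ he in
/-- **THE RE-CUT (CMP) BINDER `hcoeffMem` AT THE DATUM `Γ₀^{sph} = gammaSph X`, TWO ARCHIMEDEAN MEMBERS + COMPACT-TYPE GUARD («A2»)** — ★ `hcoeffMem_gammaSph` (p03, this
file's ★ predecessor `R90S9HcoeffMemAtDatum`) with its slot letters `(a₀, ha₀)` ↦ `(a₀ a₂, ha₀ ha₂, hane : a₂ ≠ a₀)` (the archimedean A-packet `{πⁿ(ξ_ι), πˢ(ξ_ι)}` at the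
non-compact place `ι`, §12.3 Prop. 12.3.3), a compact-type guard `cpt : Prop` (F0P3b's `[cptXi₀ ξ]`), the truncated-product local identities `hR₁ ∕ hR₂` asked UNDER `cpt` with
the two-member archimedean factors `(archTr₀ a₀ φ − archTr₀ a₂ φ)` ∕ `(archTr₀ a₀ φ + archTr₀ a₂ φ)` (print p. 244 last display: `(Tr πⁿ(ξ_ι) ∓ Tr πˢ(ξ_ι))(f_ι)` at `ι ∉ S₀`),
and the vanishing companions `hR₀G ∕ hR₀H` under `¬ cpt` (`∏_{v∈S₀} Tr F_v(f′_v) = 0`).  Everything else — the components map `tup` with `hspec`, `htupInj`, `htupW₀`, the pin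
`htrX`, the slot letters `hun hus hsph hne`, `T₀ hn1 hs0`, (14.6.3) `h63`, `hex` — and the CONCLUSION are ★ `hcoeffMem_gammaSph`'s, token for token.  Proof: ★
`contribMem_of_slotsA_guarded` with the support law `tuple_mem_support_of_slots₂` and the slot-form bridge ★ `memPrime_piXiPrime_of_components_eq`.
[cite: Rogawski1990, §14.6 Thm. 14.6.4 and its proof pp. 244–245 (chunks p0238 L9 – p0239 L4); §12.3 Prop. 12.3.3 p. 178; Prop. 13.8.1 p. 206; §13.1 p. 199, Prop. 13.1.4; §14.4 Props. 14.4.1 (a)(c), 14.4.2 (c) p. 236] [cite: FlathCorvallis1979, Thm. 3] -/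
theorem hcoeffMem_gammaSphA2
    (hanis : ∀ x : Fin 3 → L, Literature.AlgebraicGeometry.ShimuraVarieties.hermForm (cmConjRingHom L) H x x = 0 → x = 0)
    (X : DatumInputs ((UnitaryGroup.arch (↥(maximalRealSubfield L)) L (IsCMField.complexConj L) 3 H → ℂ) ×
        (∀ v : HeightOneSpectrum (𝓞 ↥(maximalRealSubfield L)), (cmDatum L 3 H).Local v → ℂ)) TG TH L ι₀ H T hT μA Ξ 𝔩)
    (Transfer : (UnitaryGroup.arch (↥(maximalRealSubfield L)) L (IsCMField.complexConj L) 3 H → ℂ) ×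
        (∀ v : HeightOneSpectrum (𝓞 ↥(maximalRealSubfield L)), (cmDatum L 3 H).Local v → ℂ) → TG → Prop)
    (TransferH : (UnitaryGroup.arch (↥(maximalRealSubfield L)) L (IsCMField.complexConj L) 3 H → ℂ) ×
        (∀ v : HeightOneSpectrum (𝓞 ↥(maximalRealSubfield L)), (cmDatum L 3 H).Local v → ℂ) → TH → Prop)
    -- the components map «`π′ ↦ (π′_ι, (π′_v)_v)`» with its specification, injectivity and support [R90-IF-p02 `tupleOf`; F1b + «ARCH»; R90-IF-p05]
    (tup : RepPrimeSph L ι₀ H T hT μA →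
      GKIrrClass (uFormGroup (Fin 2) (Fin 1)) × (∀ v : HeightOneSpectrum (𝓞 ↥(maximalRealSubfield L)), IrrClass ((cmDatum L 3 H).Local v)))
    (hspec : ∀ π' : RepPrimeSph L ι₀ H T hT μA,
      ∃ P₀ : DiscreteAutomorphicRep (adelicGroupData (↥(maximalRealSubfield L)) L (IsCMField.complexConj L) 3 H) μA,
        classOf L H μA P₀ = π'.1 ∧ ∀ v, (tup π').2 v = clFinChoice P₀ v)
    (htupInj : Function.Injective tup)
    (htupW₀ : ∀ π' : RepPrimeSph L ι₀ H T hT μA,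
      (∃ r : GKIrrep (uFormGroup (Fin 2) (Fin 1)), GKIrrClass.mk r = (tup π').1 ∧ IsAdmissibleGK r.ρK ∧ r.IsInfUnitaryAlongP) ∧
        (∀ v, ((tup π').2 v).IsUnitarizable) ∧
        {v | (letI : MeasurableSpace ((cmDatum L 3 H).Local v) := borel _; ((tup π').2 v).smoothTrace (μv v) (e v)) ≠ 1}.Finite)
    -- the pin «`tr′ = Θ₀ ∘ tup`» (ruling S9-R-TG; `rfl` at `X_cm`)
    (htrX : ∀ (π' : RepPrimeSph L ι₀ H T hT μA) (φf : (UnitaryGroup.arch (↥(maximalRealSubfield L)) L (IsCMField.complexConj L) 3 H → ℂ) ×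
        (∀ v : HeightOneSpectrum (𝓞 ↥(maximalRealSubfield L)), (cmDatum L 3 H).Local v → ℂ)),
      X.trPrime π' φf = archTr₀ L ι₀ H T hT νinf (tup π').1 φf.1 *
        ∏ᶠ v, (letI : MeasurableSpace ((cmDatum L 3 H).Local v) := borel _; ((tup π').2 v).smoothTrace (μv v) (φf.2 v)))
    -- the A-packet `Π(ξ)`: `ξ` one-dimensional, `m_v n_v ≠ 0` on `S₀` [Thm. 14.6.4 p. 244]
    {P : X.G.Packet} {ξ : X.G.PacketH} (h₁ : X.IsOneDimH ξ) (hS : ∀ q : InnerFormSec146.Place L, q ∈ S0 L H → X.MnNeZero ξ q)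
    -- the slots: non-split predicate, `⊗_{S₀}F_v`, and the letters on `πⁿ(ξ_v)` ∕ `πˢ(ξ_v)` [§13.1 p. 199; p. 244]
    (p : HeightOneSpectrum (𝓞 ↥(maximalRealSubfield L)) → Prop)
    -- «A2»: the TWO archimedean members `πⁿ(ξ_ι)`, `πˢ(ξ_ι)` at the non-compact place `ι` [§12.3 Prop. 12.3.3], both admissible ∧ inf-unitary, distinct
    (a₀ a₂ : GKIrrClass (uFormGroup (Fin 2) (Fin 1)))
    (ha₀ : ∃ r : GKIrrep (uFormGroup (Fin 2) (Fin 1)), GKIrrClass.mk r = a₀ ∧ IsAdmissibleGK r.ρK ∧ r.IsInfUnitaryAlongP)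
    (ha₂ : ∃ r : GKIrrep (uFormGroup (Fin 2) (Fin 1)), GKIrrClass.mk r = a₂ ∧ IsAdmissibleGK r.ρK ∧ r.IsInfUnitaryAlongP)
    (hane : a₂ ≠ a₀)
    (hun : ∀ v, ((Ξ (X.oneDimOf ξ h₁) v).πn).IsUnitarizable)
    (hus : ∀ v, p v → ((Ξ (X.oneDimOf ξ h₁) v).πs.getD (Ξ (X.oneDimOf ξ h₁) v).πn).IsUnitarizable)
    (hsph : {v | (letI : MeasurableSpace ((cmDatum L 3 H).Local v) := borel _;
      ((Ξ (X.oneDimOf ξ h₁) v).πn).smoothTrace (μv v) (e v)) ≠ 1}.Finite)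
    (hne : ∀ i : {v // p v}, (Ξ (X.oneDimOf ξ h₁) (i : _)).πs.getD (Ξ (X.oneDimOf ξ h₁) (i : _)).πn ≠ (Ξ (X.oneDimOf ξ h₁) (i : _)).πn)
    -- exceptional sets, the two local laws, the truncated-product local identities [S2 ∕ S3 ∕ S7]
    (T₀ : (UnitaryGroup.arch (↥(maximalRealSubfield L)) L (IsCMField.complexConj L) 3 H → ℂ) ×
        (∀ v : HeightOneSpectrum (𝓞 ↥(maximalRealSubfield L)), (cmDatum L 3 H).Local v → ℂ) →
      Finset (HeightOneSpectrum (𝓞 ↥(maximalRealSubfield L))))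
    (hn1 : ∀ φf, (ArchTestKc L ι₀ H T hT φf.1 ∧ (∀ v, IsLocallyConstant (φf.2 v) ∧ HasCompactSupport (φf.2 v)) ∧ {v | φf.2 v ≠ e v}.Finite) →
      ∀ v ∉ T₀ φf, (letI : MeasurableSpace ((cmDatum L 3 H).Local v) := borel _;
        ((Ξ (X.oneDimOf ξ h₁) v).πn).smoothTrace (μv v) (φf.2 v)) = 1)
    (hs0 : ∀ φf, (ArchTestKc L ι₀ H T hT φf.1 ∧ (∀ v, IsLocallyConstant (φf.2 v) ∧ HasCompactSupport (φf.2 v)) ∧ {v | φf.2 v ≠ e v}.Finite) →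
      ∀ i : {v // p v}, (i : HeightOneSpectrum (𝓞 ↥(maximalRealSubfield L))) ∉ T₀ φf →
        (letI : MeasurableSpace ((cmDatum L 3 H).Local i) := borel _;
          ((Ξ (X.oneDimOf ξ h₁) (i : _)).πs.getD (Ξ (X.oneDimOf ξ h₁) (i : _)).πn).smoothTrace (μv i) (φf.2 i)) = 0)
    -- «A2»: the compact-type guard and the four local-identity readings [§14.4 Props. 14.4.1 (a)(c), 14.4.2 (c); Prop. 13.1.4; p. 244 last display]
    (cpt : Prop)
    (hR₁ : cpt → ∀ φf (f : TG), (ArchTestKc L ι₀ H T hT φf.1 ∧ (∀ v, IsLocallyConstant (φf.2 v) ∧ HasCompactSupport (φf.2 v)) ∧ {v | φf.2 v ≠ e v}.Finite) →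
      Transfer φf f →
      X.G.packetTrace X.tr P f =
        (-1) ^ (gammaSph _ TG TH L ι₀ H T hT μA Ξ 𝔩 X).N *
          ((archTr₀ L ι₀ H T hT νinf a₀ φf.1 - archTr₀ L ι₀ H T hT νinf a₂ φf.1) *
            ∏ v ∈ T₀ φf with ¬ p v, (letI : MeasurableSpace ((cmDatum L 3 H).Local v) := borel _;
              ((Ξ (X.oneDimOf ξ h₁) v).πn).smoothTrace (μv v) (φf.2 v))) *
          ∏ i ∈ (T₀ φf).subtype p, (letI : MeasurableSpace ((cmDatum L 3 H).Local i) := borel _;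
            (((Ξ (X.oneDimOf ξ h₁) (i : _)).πn).smoothTrace (μv i) (φf.2 i) -
              ((Ξ (X.oneDimOf ξ h₁) (i : _)).πs.getD (Ξ (X.oneDimOf ξ h₁) (i : _)).πn).smoothTrace (μv i) (φf.2 i))))
    (hR₂ : cpt → ∀ φf (fH : TH), (ArchTestKc L ι₀ H T hT φf.1 ∧ (∀ v, IsLocallyConstant (φf.2 v) ∧ HasCompactSupport (φf.2 v)) ∧ {v | φf.2 v ≠ e v}.Finite) →
      TransferH φf fH →
      X.trH ξ fH =
        (-1) ^ (gammaSph _ TG TH L ι₀ H T hT μA Ξ 𝔩 X).N * (gammaSph _ TG TH L ι₀ H T hT μA Ξ 𝔩 X).c *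
          ((archTr₀ L ι₀ H T hT νinf a₀ φf.1 + archTr₀ L ι₀ H T hT νinf a₂ φf.1) *
            ∏ v ∈ T₀ φf with ¬ p v, (letI : MeasurableSpace ((cmDatum L 3 H).Local v) := borel _;
              ((Ξ (X.oneDimOf ξ h₁) v).πn).smoothTrace (μv v) (φf.2 v))) *
          ∏ i ∈ (T₀ φf).subtype p, (letI : MeasurableSpace ((cmDatum L 3 H).Local i) := borel _;
            (((Ξ (X.oneDimOf ξ h₁) (i : _)).πn).smoothTrace (μv i) (φf.2 i) +
              ((Ξ (X.oneDimOf ξ h₁) (i : _)).πs.getD (Ξ (X.oneDimOf ξ h₁) (i : _)).πn).smoothTrace (μv i) (φf.2 i))))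
    (hR₀G : ¬ cpt → ∀ φf (f : TG), (ArchTestKc L ι₀ H T hT φf.1 ∧ (∀ v, IsLocallyConstant (φf.2 v) ∧ HasCompactSupport (φf.2 v)) ∧ {v | φf.2 v ≠ e v}.Finite) →
      Transfer φf f → X.G.packetTrace X.tr P f = 0)
    (hR₀H : ¬ cpt → ∀ φf (fH : TH), (ArchTestKc L ι₀ H T hT φf.1 ∧ (∀ v, IsLocallyConstant (φf.2 v) ∧ HasCompactSupport (φf.2 v)) ∧ {v | φf.2 v ≠ e v}.Finite) →
      TransferH φf fH → X.trH ξ fH = 0)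
    -- (14.6.3) on the restricted pure tensors, `HasSum` form [R90-IF-p07 #4′], and transfer existence [S6]
    (h63 : ∀ φf, (ArchTestKc L ι₀ H T hT φf.1 ∧ (∀ v, IsLocallyConstant (φf.2 v) ∧ HasCompactSupport (φf.2 v)) ∧ {v | φf.2 v ≠ e v}.Finite) →
      ∀ (f : TG) (fH : TH), Transfer φf f → TransferH φf fH →
      HasSum (fun π' => {π' : (gammaSph _ TG TH L ι₀ H T hT μA Ξ 𝔩 X).Rep' | (gammaSph _ TG TH L ι₀ H T hT μA Ξ 𝔩 X).evpRep π' P}.indicator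
          (fun π' => ((gammaSph _ TG TH L ι₀ H T hT μA Ξ 𝔩 X).m' π' : ℂ) * (gammaSph _ TG TH L ι₀ H T hT μA Ξ 𝔩 X).tr' π' φf) π')
        (1 / 2 * X.G.packetTrace X.tr P f + 1 / 2 * X.trH ξ fH))
    (hex : ∀ φf, (ArchTestKc L ι₀ H T hT φf.1 ∧ (∀ v, IsLocallyConstant (φf.2 v) ∧ HasCompactSupport (φf.2 v)) ∧ {v | φf.2 v ≠ e v}.Finite) →
      ∃ (f : TG) (fH : TH), Transfer φf f ∧ TransferH φf fH) :
    ∀ π' : (gammaSph _ TG TH L ι₀ H T hT μA Ξ 𝔩 X).Rep',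
      (gammaSph _ TG TH L ι₀ H T hT μA Ξ 𝔩 X).evpRep π' P → (gammaSph _ TG TH L ι₀ H T hT μA Ξ 𝔩 X).m' π' ≠ 0 →
        (gammaSph _ TG TH L ι₀ H T hT μA Ξ 𝔩 X).mem' π' ((gammaSph _ TG TH L ι₀ H T hT μA Ξ 𝔩 X).PiXi' ξ h₁ hS) := by
  -- ★ p862002 in `IsCountablyLinIndepOn` currency: the tuple-side linear independence
  have hli := globalCharactersLinIndep_isCountablyLinIndepOn L ι₀ H T hT νinf μv hdef hν hμ e he
  refine contribMem_of_slotsA_guarded (gammaSph _ TG TH L ι₀ H T hT μA Ξ 𝔩 X) Transfer TransferH p h₁ hS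
    (fun φf => ArchTestKc L ι₀ H T hT φf.1 ∧ (∀ v, IsLocallyConstant (φf.2 v) ∧ HasCompactSupport (φf.2 v)) ∧ {v | φf.2 v ≠ e v}.Finite)
    Set.univ (fun _ _ _ => Set.mem_univ _) tup htupInj.injOn
    (fun x φf => archTr₀ L ι₀ H T hT νinf x.1 φf.1 *
      ∏ᶠ v, (letI : MeasurableSpace ((cmDatum L 3 H).Local v) := borel _; (x.2 v).smoothTrace (μv v) (φf.2 v)))
    (fun φf a => archTr₀ L ι₀ H T hT νinf a φf.1)
    (fun φf v y => (letI : MeasurableSpace ((cmDatum L 3 H).Local v) := borel _; y.smoothTrace (μv v) (φf.2 v)))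
    (fun _ _ _ => rfl) (fun π' _ φf _ => htrX π' φf) _ hli (fun π' _ => htupW₀ π')
    a₀ a₂ hane (fun v => (Ξ (X.oneDimOf ξ h₁) v).πn) (fun v => (Ξ (X.oneDimOf ξ h₁) v).πs.getD (Ξ (X.oneDimOf ξ h₁) v).πn) hne
    (fun x hx₁ hx₂ hxfin => by
      rcases hx₁ with hx₁ | hx₁
      · exact tuple_mem_support_of_slots L H μv e p a₀ ha₀ _ _ hun hus hsph x hx₁ hx₂ hxfin
      · exact tuple_mem_support_of_slots L H μv e p a₂ ha₂ _ _ hun hus hsph x hx₁ hx₂ hxfin)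
    T₀ hn1 hs0 cpt hR₁ hR₂ hR₀G hR₀H h63 hex ?_
  -- the membership bridge in slot form (★ `memPrime_piXiPrime_of_components_eq`, R90-IF-p05), read back through `gammaSph_mem'` ∕ `gammaSph_PiXi'`: finite slots only
  intro π' _ _ hslots
  exact memPrime_piXiPrime_of_components_eq L H μA Ξ hanis π'.1 (tup π').2 (hspec π') (X.oneDimOf ξ h₁) fun v => by
    rcases hslots v with h | ⟨_, h⟩
    · rw [h]; exact (Ξ (X.oneDimOf ξ h₁) v).πn_mem_members
    · rw [h]; exact getD_πs_mem_members (Ξ (X.oneDimOf ξ h₁) v)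

end Datum

end Summit.HodgeConjecture.HodgeConjecture.R90.S9

end
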